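import Summits.Ventures.PercRepro.ConnJoin

/-!
# Connectivity inside a star part (generic)

A part `i` is a **star at `h`** when every edge of the part has `h` as an endpoint (a hub with its
edges to the terminals; the one-vertex branches of the star gadget).  Inside such a part, two
vertices are connected iff they are equal or both **touch** `h` — are `h` or are joined to `h` by an
open edge of the part (`connIn_star_iff`).  So the per-part data of the profile theorem for a hub is
decided by single edge facts, which is what the hub tables of the graph half tabulate.  More
generally, in a part whose edges are covered by a hub set, connectivity reduces to hub–hub
connectivity plus single edge facts (`connIn_iff_hubs`; two hubs = the pure-pair branches).
-/

namespace PercRepro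

namespace MultiGraph

variable {V E ι : Type*} (G : MultiGraph V E)

/-- `u` is the hub `h` or joined to it by an open edge of the part `i`. -/
def StarTouch (S : Config E) (pe : E → ι) (i : ι) (h u : V) : Prop :=
  u = h ∨ G.OpenAdjIn S pe i u h

variable {G}

/-- In a star part at `h`, an open part step ends at two vertices touching `h`. -/
theorem OpenAdjIn.starTouch {S : Config E} {pe : E → ι} {i : ι} {h : V}
    (hstar : ∀ e, pe e = i → G.fst e = h ∨ G.snd e = h) {u v : V}
    (huv : G.OpenAdjIn S pe i u v) : G.StarTouch S pe i h u ∧ G.StarTouch S pe i h v := by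
  obtain ⟨e, hi, he, hend⟩ := huv
  rcases hstar e hi with hh | hh
  · rcases hend with ⟨h1, h2⟩ | ⟨h1, h2⟩
    · -- `fst e = h = u`, `snd e = v`
      exact ⟨Or.inl (h1.symm.trans hh), Or.inr ⟨e, hi, he, Or.inr ⟨hh, h2⟩⟩⟩
    · -- `fst e = h = v`, `snd e = u`
      exact ⟨Or.inr ⟨e, hi, he, Or.inr ⟨hh, h2⟩⟩, Or.inl (h1.symm.trans hh)⟩
  · rcases hend with ⟨h1, h2⟩ | ⟨h1, h2⟩
    · -- `fst e = u`, `snd e = h = v`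
      exact ⟨Or.inr ⟨e, hi, he, Or.inl ⟨h1, hh⟩⟩, Or.inl (h2.symm.trans hh)⟩
    · -- `fst e = v`, `snd e = h = u`
      exact ⟨Or.inl (h2.symm.trans hh), Or.inr ⟨e, hi, he, Or.inl ⟨h1, hh⟩⟩⟩

/-- **Connectivity in a star part**: equal, or both touching the hub. -/
theorem connIn_star_iff {S : Config E} {pe : E → ι} {i : ι} {h : V}
    (hstar : ∀ e, pe e = i → G.fst e = h ∨ G.snd e = h) (u v : V) :
    G.ConnIn S pe i u v ↔ u = v ∨ (G.StarTouch S pe i h u ∧ G.StarTouch S pe i h v) := by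
  constructor
  · intro hc
    induction hc with
    | refl => exact Or.inl rfl
    | tail _ hwv ih =>
      obtain ⟨htw, htv⟩ := OpenAdjIn.starTouch hstar hwv
      rcases ih with rfl | ⟨htu, _⟩
      · exact Or.inr ⟨htw, htv⟩
      · exact Or.inr ⟨htu, htv⟩
  · rintro (rfl | ⟨htu, htv⟩)
    · exact Relation.ReflTransGen.refl
    · -- `u → h → v`, each leg one open part step or nothing
      have hu : G.ConnIn S pe i u h := by
        rcases htu with rfl | huh
        · exact Relation.ReflTransGen.refl
        · exact Relation.ReflTransGen.single huh
      have hv : G.ConnIn S pe i h v := by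
        rcases htv with rfl | hvh
        · exact Relation.ReflTransGen.refl
        · exact Relation.ReflTransGen.single hvh.symm
      exact hu.trans hv

/-- **Connectivity in a part with a hub cover.** If every edge of the part `i` has an endpoint in
the hub set `Hb`, two vertices are connected inside the part iff they are equal or each touches a
hub (is one, or is joined to one by an open edge of the part) and the two hubs are connected inside
the part.  One hub: `connIn_star_iff`; two hubs: the pure-pair branches. -/
theorem connIn_iff_hubs {S : Config E} {pe : E → ι} {i : ι} {Hb : Set V}
    (hcover : ∀ e, pe e = i → G.fst e ∈ Hb ∨ G.snd e ∈ Hb) (u v : V) :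
    G.ConnIn S pe i u v ↔ u = v ∨ ∃ h ∈ Hb, ∃ h' ∈ Hb,
      G.StarTouch S pe i h u ∧ G.StarTouch S pe i h' v ∧ G.ConnIn S pe i h h' := by
  constructor
  · intro hc
    induction hc with
    | refl => exact Or.inl rfl
    | @tail w v _ hwv ih =>
      -- the edge of the step touches a hub `g`; the step joins `w` and `v`
      obtain ⟨e, hi, he, hend⟩ := hwv
      -- `g ∈ Hb` with: `w = g` and `OpenAdjIn v g`, or `v = g` and `OpenAdjIn w g`
      have hg : ∃ g ∈ Hb, (w = g ∧ G.OpenAdjIn S pe i v g) ∨ (v = g ∧ G.OpenAdjIn S pe i w g) := by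
        rcases hcover e hi with hH | hH
        · rcases hend with ⟨h1, h2⟩ | ⟨h1, h2⟩
          · exact ⟨G.fst e, hH, Or.inl ⟨h1.symm, e, hi, he, Or.inr ⟨rfl, h2⟩⟩⟩
          · exact ⟨G.fst e, hH, Or.inr ⟨h1.symm, e, hi, he, Or.inr ⟨rfl, h2⟩⟩⟩
        · rcases hend with ⟨h1, h2⟩ | ⟨h1, h2⟩
          · exact ⟨G.snd e, hH, Or.inr ⟨h2.symm, e, hi, he, Or.inl ⟨h1, rfl⟩⟩⟩
          · exact ⟨G.snd e, hH, Or.inl ⟨h2.symm, e, hi, he, Or.inl ⟨h1, rfl⟩⟩⟩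
      obtain ⟨g, hgH, hcase⟩ := hg
      -- a vertex touching a hub `h'` is connected to it inside the part
      have touch_conn : ∀ {h' z : V}, G.StarTouch S pe i h' z → G.ConnIn S pe i h' z := by
        rintro h' z (rfl | hz)
        · exact Relation.ReflTransGen.refl
        · exact Relation.ReflTransGen.single hz.symm
      rcases ih with rfl | ⟨h, hh, h', hh', htu, htw, hhh'⟩
      · -- `u = w`
        rcases hcase with ⟨rfl, hv⟩ | ⟨rfl, hw⟩
        · exact Or.inr ⟨u, hgH, u, hgH, Or.inl rfl, Or.inr hv, Relation.ReflTransGen.refl⟩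
        · exact Or.inr ⟨v, hgH, v, hgH, Or.inr hw, Or.inl rfl, Relation.ReflTransGen.refl⟩
      · -- `u` touches `h`, `w` touches `h'`, `h ~ h'`
        rcases hcase with ⟨rfl, hv⟩ | ⟨rfl, hw⟩
        · exact Or.inr ⟨h, hh, w, hgH, htu, Or.inr hv, hhh'.trans (touch_conn htw)⟩
        · exact Or.inr ⟨h, hh, v, hgH, htu, Or.inl rfl,
            hhh'.trans ((touch_conn htw).trans (Relation.ReflTransGen.single hw))⟩
  · rintro (rfl | ⟨h, _, h', _, htu, htv, hhh'⟩)
    · exact Relation.ReflTransGen.refl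
    · have hu : G.ConnIn S pe i u h := by
        rcases htu with rfl | huh
        · exact Relation.ReflTransGen.refl
        · exact Relation.ReflTransGen.single huh
      have hv : G.ConnIn S pe i h' v := by
        rcases htv with rfl | hvh
        · exact Relation.ReflTransGen.refl
        · exact Relation.ReflTransGen.single hvh.symm
      exact (hu.trans hhh').trans hv

end MultiGraph

end PercRepro
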